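import Literature.NumberTheory.GaloisRepresentations.BrauerTowerBound
import Literature.NumberTheory.GaloisRepresentations.CyclicClassRestrict
import Literature.NumberTheory.GaloisRepresentations.LocalNormIndex
import Literature.NumberTheory.GaloisRepresentations.LocalUnramifiedNormGroups
import HarnessLib

/-!
# The Brauer group of a local field via unramified cyclic classes (Serre, *Corps locaux* XIII §3)

Let `F` be a non-archimedean local field of characteristic `0`, `L₁/F` a finite Galois extension
inside `F̄` containing the unramified level `F_m` of `F`, and `D ≤ Gal(L₁/F)` with fixed field `K`
(`fieldOf`), `Γ_K = Gal(F̄/K)` (`layerN L₁ D`).  The subgroup `D_m = D ∩ Gal(L₁/F_m)` (`unrLayer`)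
has fixed field the unramified extension `K_m = K F_m` of `K` (`LocalUnramifiedNormGroups.lean`),
and for `f_K ∣ m` the layer `Γ_K/Γ_{K_m}` is cyclic of order `d = m / f_K` (`natCard_quot_unrLayer`,
`isCyclic_quot_unrLayer`).  For a cyclic layer `θ : Γ_K → ℤ/d` with kernel `Γ_{K_m}` we prove:

* `cyclicClass_eq_zero_of_dvd_tVal` — **`κ_θ(a) = 0` if `m ∣ t_K(a)`** (such `a ∈ Kˣ` are norms from
  `K_m`, `range_unitsMap_norm_unrLevel`, and `κ` kills norms); in particular for units of `K`;
* `dvd_of_nsmul_cyclicClass_uniformizer_eq_zero` — **`κ_θ(π_K)` has order exactly `d`** for a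
  uniformiser `π_K` (`t_K(π_K) = f_K`): if `j κ(π_K) = 0` then `π_K^j` is a norm from `K_m`
  (`exists_cycNorm_eq_of_cyclicClass_eq_zero`, Hilbert 90), so `m ∣ j f_K`.

The restriction to a subfield and the cyclicity of `Br(L/K)` are in `LocalUnramifiedBrauerCyclic.lean`.

## References
* J.-P. Serre, *Corps locaux*, Hermann, 1968, XIII §3 (Prop. 6, 7), V §2. [SerreLocalFields1979]
* J. Neukirch, *Algebraic Number Theory*, Springer, 1999, Ch. V §1. [NeukirchANT1999]
-/

noncomputable section

open CategoryTheory Function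
open Field IsNonarchimedeanLocalField ValuativeRel IntermediateField

universe u

namespace Literature.NumberTheory.GaloisRepresentations

open _root_.TopRep _root_.ContRepresentation _root_.ContinuousCohomology DiscreteGaloisModule
open LocalWeilDatum

/-! ### Generator data of a cyclic layer with prescribed kernel -/

section GenData

variable {G : Type u} [Group G] [TopologicalSpace G] {d : ℕ} [NeZero d] (χ : CyclicCharacter G d)

/-- **The class of an element of character `1` generates `G / ker χ`.** [folklore] -/
theorem CyclicCharacter.forall_mem_zpowers_mk (N : Subgroup G) [N.Normal] (hN : χ.ker = N)
    {σ : G} (hσ : χ σ = 1) : ∀ x : G ⧸ N, x ∈ Subgroup.zpowers (σ : G ⧸ N) := by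
  intro x
  obtain ⟨g, rfl⟩ := QuotientGroup.mk_surjective x
  refine Subgroup.mem_zpowers_iff.2 ⟨((χ g).val : ℤ), ?_⟩
  rw [zpow_natCast, ← QuotientGroup.mk_pow, QuotientGroup.eq, ← hN]
  exact χ.pow_val_inv_mul_mem_ker hσ g

/-- **`|G / ker χ| = d`.** [folklore] -/
theorem CyclicCharacter.natCard_quotient_eq (N : Subgroup G) [N.Normal] (hN : χ.ker = N) :
    Nat.card (G ⧸ N) = d := by
  rw [← Subgroup.index_eq_card, ← hN, χ.index_ker]

end GenData

section Frame

variable (F : Type u) [Field F] [ValuativeRel F] [TopologicalSpace F] [IsNonarchimedeanLocalField F]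
  [CharZero F]
variable (L₁ : IntermediateField F (AlgebraicClosure F)) [FiniteDimensional F L₁] [IsGalois F L₁]

omit [ValuativeRel F] [TopologicalSpace F] [IsNonarchimedeanLocalField F] in
/-- In characteristic `0` every subextension of `F̄` is separable. [folklore] -/
theorem le_sepClosure_of_charZero (K : IntermediateField F (AlgebraicClosure F)) : K ≤ sepClosure F :=
  fun x _ => mem_separableClosure_iff.2 (Algebra.IsSeparable.isSeparable F x)

/-! ### The fields and subgroups of the frame -/

/-- **The field `K = L₁^D ⊆ F̄` of a subgroup `D ≤ Gal(L₁/F)`.** [folklore] -/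
abbrev fieldOf (D : Subgroup (L₁ ≃ₐ[F] L₁)) : IntermediateField F (AlgebraicClosure F) :=
  lift (fixedField D)

/-- `K/F` is finite. [folklore] -/
instance finiteDimensional_fieldOf (D : Subgroup (L₁ ≃ₐ[F] L₁)) :
    FiniteDimensional F (fieldOf F L₁ D) :=
  (liftAlgEquiv (fixedField D)).toLinearEquiv.finiteDimensional

omit [ValuativeRel F] [TopologicalSpace F] [IsNonarchimedeanLocalField F] [CharZero F]
  [FiniteDimensional F L₁] [IsGalois F L₁] in
/-- `K ≤ L₁`. [folklore] -/
theorem fieldOf_le (D : Subgroup (L₁ ≃ₐ[F] L₁)) : fieldOf F L₁ D ≤ L₁ := lift_le _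

/-- **The unramified subgroup `Gal(L₁/F_m) ≤ Gal(L₁/F)`** (image of `Gal(F̄/F_m)`). [folklore] -/
def unrSub (m : ℕ) : Subgroup (L₁ ≃ₐ[F] L₁) := (galFixing F (unramifiedLevel F m)).map (resGal L₁)

omit [CharZero F] [FiniteDimensional F L₁] in
/-- `Gal(F̄/L₁^{U_m}) = Gal(F̄/F_m)` when `F_m ≤ L₁`. [folklore] -/
theorem layerN_unrSub {m : ℕ} (hmL : unramifiedLevel F m ≤ L₁) :
    layerN L₁ (unrSub F L₁ m) = galFixing F (unramifiedLevel F m) := by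
  rw [layerN, unrSub, Subgroup.comap_map_eq_self]
  rw [ker_resGal]
  exact galFixing_antitone F hmL

omit [CharZero F] [FiniteDimensional F L₁] in
/-- `U_m` is normal in `Gal(L₁/F)` (`F_m/F` is Galois). [folklore] -/
theorem normal_unrSub {m : ℕ} (hm : 0 < m) : (unrSub F L₁ m).Normal := by
  haveI := (unramifiedLevel_finite_abelian_unramified F hm).2.1
  haveI : (galFixing F (unramifiedLevel F m)).Normal := normal_galFixing (unramifiedLevel F m)
  exact Subgroup.Normal.map inferInstance _ (resGal_surjective L₁)

/-- **The unramified layer `D_m = D ∩ U_m`** (fixed field `K_m = K F_m`). [folklore] -/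
def unrLayer (D : Subgroup (L₁ ≃ₐ[F] L₁)) (m : ℕ) : Subgroup (L₁ ≃ₐ[F] L₁) := D ⊓ unrSub F L₁ m

omit [CharZero F] [FiniteDimensional F L₁] in
/-- `D_m ≤ D`. [folklore] -/
theorem unrLayer_le (D : Subgroup (L₁ ≃ₐ[F] L₁)) (m : ℕ) : unrLayer F L₁ D m ≤ D := inf_le_left

omit [CharZero F] [FiniteDimensional F L₁] in
/-- `D_m ⊴ D`. [folklore] -/
theorem normal_unrLayer (D : Subgroup (L₁ ≃ₐ[F] L₁)) {m : ℕ} (hm : 0 < m) :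
    ((unrLayer F L₁ D m).subgroupOf D).Normal := by
  haveI := normal_unrSub F L₁ hm
  have h : (unrLayer F L₁ D m).subgroupOf D = (unrSub F L₁ m).subgroupOf D := by
    ext x
    simp only [unrLayer, Subgroup.mem_subgroupOf, Subgroup.mem_inf, SetLike.coe_mem, true_and]
  rw [h]
  infer_instance

omit [CharZero F] in
/-- **`Gal(F̄/L₁^{D_m}) = Gal(F̄/K_m)`**, `K_m = K F_m` (`F_m ≤ L₁`). [folklore] -/
theorem layerN_unrLayer (D : Subgroup (L₁ ≃ₐ[F] L₁)) {m : ℕ} (hmL : unramifiedLevel F m ≤ L₁) :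
    layerN L₁ (unrLayer F L₁ D m) = galFixing F (unrLevel F (fieldOf F L₁ D) m) := by
  rw [unrLevel, galFixing_sup, ← layerN_eq_galFixing, ← layerN_unrSub F L₁ hmL, unrLayer, layerN,
    Subgroup.comap_inf]

omit [CharZero F] [FiniteDimensional F L₁] [IsGalois F L₁] in
/-- `K_m ≤ L₁`. [folklore] -/
theorem unrLevel_fieldOf_le (D : Subgroup (L₁ ≃ₐ[F] L₁)) {m : ℕ} (hmL : unramifiedLevel F m ≤ L₁) :
    unrLevel F (fieldOf F L₁ D) m ≤ L₁ :=
  sup_le (fieldOf_le F L₁ D) hmL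

/-! ### The field isomorphisms `L₁^D ≅ K`, `(L₁^D)' ≅ K_m` -/

/-- **`E = L₁^D ≅ K ⊆ F̄`** (the same set). [folklore] -/
def baseEquiv (D : Subgroup (L₁ ≃ₐ[F] L₁)) : layerBase L₁ D ≃ₐ[F] fieldOf F L₁ D :=
  liftAlgEquiv (fixedField D)

omit [ValuativeRel F] [TopologicalSpace F] [IsNonarchimedeanLocalField F] [CharZero F]
  [FiniteDimensional F L₁] [IsGalois F L₁] in
/-- `baseEquiv` preserves the underlying element of `F̄`. [folklore] -/
@[simp] theorem coe_baseEquiv (D : Subgroup (L₁ ≃ₐ[F] L₁)) (x : layerBase L₁ D) :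
    ((baseEquiv F L₁ D x : fieldOf F L₁ D) : AlgebraicClosure F) = ((x : L₁) : AlgebraicClosure F) :=
  rfl

variable {L₁}
variable {D : Subgroup (L₁ ≃ₐ[F] L₁)} {m : ℕ}

/-- An element of the layer top lies in `K_m`. [folklore] -/
theorem coe_mem_unrLevel_of_mem_layerTop (hmL : unramifiedLevel F m ≤ L₁)
    (y : layerTop L₁ D (unrLayer F L₁ D m)) :
    (((y : layerTop L₁ D (unrLayer F L₁ D m)) : L₁) : AlgebraicClosure F) ∈
      unrLevel F (fieldOf F L₁ D) m := by
  have hy := (mem_layerTop_iff L₁ (unrLayer_le F L₁ D m) ((y : layerTop L₁ D _) : L₁)).1 y.2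
  have h := coe_mem_of_forall_galFixing_smul F (le_sepClosure_of_charZero F _)
    (x := ⟨((y : L₁) : AlgebraicClosure F), le_sepClosure_of_charZero F L₁ (y : L₁).2⟩)
    (fun σ hσ => by
      rw [← layerN_unrLayer F L₁ D hmL] at hσ
      change σ • ((y : L₁) : AlgebraicClosure F) = ((y : L₁) : AlgebraicClosure F)
      rw [← coe_resGal_apply]
      exact congrArg (fun z : L₁ => (z : AlgebraicClosure F)) (hy _ hσ))
  exact h

omit [CharZero F] in
/-- An element of `K_m` lies in `L₁` and in the layer top. [folklore] -/
theorem mem_layerTop_of_mem_unrLevel (hmL : unramifiedLevel F m ≤ L₁) {z : AlgebraicClosure F}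
    (hz : z ∈ unrLevel F (fieldOf F L₁ D) m) :
    (⟨z, unrLevel_fieldOf_le F L₁ D hmL hz⟩ : L₁) ∈ layerTop L₁ D (unrLayer F L₁ D m) := by
  rw [mem_layerTop_iff L₁ (unrLayer_le F L₁ D m)]
  intro τ hτ
  obtain ⟨σ, rfl⟩ := resGal_surjective L₁ τ
  have hσ : σ ∈ layerN L₁ (unrLayer F L₁ D m) := hτ
  rw [layerN_unrLayer F L₁ D hmL, mem_galFixing_iff] at hσ
  apply Subtype.ext
  rw [coe_resGal_apply]
  exact hσ z hz

/-- **`E' ≅ K_m`**: the top of the unramified layer is the unramified extension `K_m = K F_m` of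
`K` (the same subset of `F̄`). [folklore] -/
def topEquiv (hmL : unramifiedLevel F m ≤ L₁) :
    layerTop L₁ D (unrLayer F L₁ D m) ≃+* unrLevel F (fieldOf F L₁ D) m where
  toFun y := ⟨_, coe_mem_unrLevel_of_mem_layerTop F hmL y⟩
  invFun z := ⟨_, mem_layerTop_of_mem_unrLevel F hmL z.2⟩
  left_inv _ := rfl
  right_inv _ := rfl
  map_mul' _ _ := rfl
  map_add' _ _ := rfl

/-- `topEquiv` preserves the underlying element of `F̄`. [folklore] -/
@[simp] theorem coe_topEquiv (hmL : unramifiedLevel F m ≤ L₁) (y : layerTop L₁ D (unrLayer F L₁ D m)) :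
    ((topEquiv F hmL y : unrLevel F (fieldOf F L₁ D) m) : AlgebraicClosure F) =
      ((y : L₁) : AlgebraicClosure F) :=
  rfl

/-- `topEquiv⁻¹` preserves the underlying element of `F̄`. [folklore] -/
@[simp] theorem coe_topEquiv_symm (hmL : unramifiedLevel F m ≤ L₁) (z : unrLevel F (fieldOf F L₁ D) m) :
    ((((topEquiv F hmL).symm z : layerTop L₁ D (unrLayer F L₁ D m)) : L₁) : AlgebraicClosure F) = z :=
  rfl

/-- **The two squares `E → E'`, `K → K_m` commute.** [folklore] -/
theorem topEquiv_comp_algebraMap (hmL : unramifiedLevel F m ≤ L₁) :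
    letI := towerAlgebra (le_unrLevel F (fieldOf F L₁ D) m)
    (algebraMap (fieldOf F L₁ D) (unrLevel F (fieldOf F L₁ D) m)).comp
        ((baseEquiv F L₁ D : layerBase L₁ D ≃+* fieldOf F L₁ D) : layerBase L₁ D →+* fieldOf F L₁ D) =
      ((topEquiv F hmL : layerTop L₁ D (unrLayer F L₁ D m) ≃+* _) : _ →+* _).comp
        (algebraMap (layerBase L₁ D) (layerTop L₁ D (unrLayer F L₁ D m))) :=
  RingHom.ext fun _ => Subtype.ext rfl

/-! ### The layer `Γ_K / Γ_{K_m}` is cyclic of order `m / f_K` -/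

variable (L₁ D)

/-- **`[E' : E] = m / f_K`** for `f_K ∣ m`, `F_m ≤ L₁`. [cite: SerreLocalFields1979, XIII §3] -/
theorem finrank_layerTop_unrLayer (hm : 0 < m) (hmL : unramifiedLevel F m ≤ L₁)
    (hfm : fDeg F (fieldOf F L₁ D) ∣ m) :
    Module.finrank (layerBase L₁ D) (layerTop L₁ D (unrLayer F L₁ D m)) = m / fDeg F (fieldOf F L₁ D) := by
  letI := towerAlgebra (le_unrLevel F (fieldOf F L₁ D) m)
  rw [Algebra.finrank_eq_of_equiv_equiv (baseEquiv F L₁ D : layerBase L₁ D ≃+* fieldOf F L₁ D)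
    (topEquiv F hmL : layerTop L₁ D (unrLayer F L₁ D m) ≃+* _) (topEquiv_comp_algebraMap F hmL)]
  exact finrank_unrLevel F (fieldOf F L₁ D) (le_sepClosure_of_charZero F _) hm hfm

/-- **`|Γ_K / Γ_{K_m}| = m / f_K`.** [cite: SerreLocalFields1979, XIII §3] -/
theorem natCard_quot_unrLayer (hm : 0 < m) (hmL : unramifiedLevel F m ≤ L₁)
    (hfm : fDeg F (fieldOf F L₁ D) ∣ m) :
    haveI := normal_layerN'_subgroupOf L₁ (unrLayer_le F L₁ D m) (normal_unrLayer F L₁ D hm)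
    Nat.card (layerN L₁ D ⧸ layerS L₁ D (unrLayer F L₁ D m)) = m / fDeg F (fieldOf F L₁ D) := by
  haveI := normal_layerN'_subgroupOf L₁ (unrLayer_le F L₁ D m) (normal_unrLayer F L₁ D hm)
  haveI := isGalois_layerTop L₁ (unrLayer_le F L₁ D m) (normal_unrLayer F L₁ D hm)
  haveI : FiniteDimensional (layerBase L₁ D) L₁ := IntermediateField.finiteDimensional_right _
  haveI : FiniteDimensional (layerBase L₁ D) (layerTop L₁ D (unrLayer F L₁ D m)) :=
    IntermediateField.finiteDimensional_left _
  rw [Nat.card_congr (galQuotEquiv L₁ (unrLayer_le F L₁ D m) (normal_unrLayer F L₁ D hm)),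
    IsGalois.card_aut_eq_finrank]
  exact finrank_layerTop_unrLayer F L₁ D hm hmL hfm

/-- **`Γ_K / Γ_{K_m}` is cyclic** (as is `Gal(K_m/K)`, generated by the Frobenius).
[cite: SerreLocalFields1979, XIII §3] -/
theorem isCyclic_quot_unrLayer (hm : 0 < m) (hmL : unramifiedLevel F m ≤ L₁) :
    haveI := normal_layerN'_subgroupOf L₁ (unrLayer_le F L₁ D m) (normal_unrLayer F L₁ D hm)
    IsCyclic (layerN L₁ D ⧸ layerS L₁ D (unrLayer F L₁ D m)) := by
  haveI := normal_layerN'_subgroupOf L₁ (unrLayer_le F L₁ D m) (normal_unrLayer F L₁ D hm)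
  letI := towerAlgebra (le_unrLevel F (fieldOf F L₁ D) m)
  haveI := isCyclic_gal_unrLevel F (fieldOf F L₁ D) (le_sepClosure_of_charZero F _) hm
  -- `Gal(E'/E)` is cyclic by transport from `Gal(K_m/K)`
  have he : (algebraMap (layerBase L₁ D) (layerTop L₁ D (unrLayer F L₁ D m))).comp
      (((baseEquiv F L₁ D : layerBase L₁ D ≃+* fieldOf F L₁ D).symm : fieldOf F L₁ D →+* _)) =
      (((topEquiv F hmL : layerTop L₁ D (unrLayer F L₁ D m) ≃+* _).symm : _ →+* _)).comp
        (algebraMap (fieldOf F L₁ D) (unrLevel F (fieldOf F L₁ D) m)) :=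
    RingHom.ext fun _ => Subtype.ext (Subtype.ext rfl)
  haveI : IsCyclic (layerTop L₁ D (unrLayer F L₁ D m) ≃ₐ[layerBase L₁ D]
      layerTop L₁ D (unrLayer F L₁ D m)) :=
    isCyclic_gal_of_equiv_equiv _ _ he
  -- and `N/N' ≅ Gal(E'/E)`
  let e := MulEquiv.ofBijective (layerQuotRes L₁ (unrLayer_le F L₁ D m) (normal_unrLayer F L₁ D hm))
    (layerQuotRes_bijective L₁ (unrLayer_le F L₁ D m) (normal_unrLayer F L₁ D hm))
  exact isCyclic_of_surjective e.symm.toMonoidHom e.symm.surjective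

end Frame

/-! ### The `K`-unit of an invariant and cyclic norms -/

section Classes

variable (F : Type u) [Field F] [ValuativeRel F] [TopologicalSpace F] [IsNonarchimedeanLocalField F]
  [CharZero F]
variable (L₁ : IntermediateField F (AlgebraicClosure F)) [FiniteDimensional F L₁] [IsGalois F L₁]
variable (D : Subgroup (L₁ ≃ₐ[F] L₁)) {m : ℕ}

attribute [local instance] compactSpace_of_isClosed_subgroup isClosed_layerN

omit [ValuativeRel F] [TopologicalSpace F] [IsNonarchimedeanLocalField F] [CharZero F] in
/-- `unitsVal (j • u) = (unitsVal u)^j`. [folklore] -/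
theorem unitsVal_nsmul (j : ℕ) (u : UnitsCarrier F) : unitsVal F (j • u) = unitsVal F u ^ j := by
  rw [← natCast_zsmul, unitsVal_zsmul, zpow_natCast]

/-- **The `K`-unit of an `N`-invariant of `F̄ˣ`** (`K = L₁^D`; `F̄^{Γ_K} = K` in characteristic `0`,
`invVal_mem_lift`). [folklore] -/
def kUnit (a : (layerRep L₁ D).toTopRep.ρ.invariants) : (fieldOf F L₁ D)ˣ :=
  Units.mk0 ⟨invVal L₁ D a, invVal_mem_lift L₁ D a⟩ fun h =>
    (unitsVal F (a : UnitsCarrier F)).ne_zero (congrArg Subtype.val h)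

omit [ValuativeRel F] [TopologicalSpace F] [IsNonarchimedeanLocalField F] in
/-- `kUnit a` is `a` in `F̄`. [folklore] -/
@[simp] theorem coe_kUnit (a : (layerRep L₁ D).toTopRep.ρ.invariants) :
    (((kUnit F L₁ D a : (fieldOf F L₁ D)ˣ) : fieldOf F L₁ D) : AlgebraicClosure F) = invVal L₁ D a := rfl

omit [ValuativeRel F] [TopologicalSpace F] [IsNonarchimedeanLocalField F] in
/-- `kUnit = baseEquiv ∘ layerBaseUnit`. [folklore] -/
theorem mapEquiv_layerBaseUnit (a : (layerRep L₁ D).toTopRep.ρ.invariants) :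
    Units.mapEquiv (baseEquiv F L₁ D : layerBase L₁ D ≃ₐ[F] fieldOf F L₁ D).toRingEquiv.toMulEquiv
      (layerBaseUnit L₁ D a) = kUnit F L₁ D a :=
  Units.ext (Subtype.ext rfl)

omit [ValuativeRel F] [TopologicalSpace F] [IsNonarchimedeanLocalField F] in
/-- `kUnit` is additive-to-multiplicative. [folklore] -/
theorem kUnit_add (a b : (layerRep L₁ D).toTopRep.ρ.invariants) :
    kUnit F L₁ D (a + b) = kUnit F L₁ D a * kUnit F L₁ D b :=
  Units.ext (Subtype.ext rfl)

omit [ValuativeRel F] [TopologicalSpace F] [IsNonarchimedeanLocalField F] in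
/-- `kUnit (j • a) = (kUnit a)^j`. [folklore] -/
theorem kUnit_nsmul (j : ℕ) (a : (layerRep L₁ D).toTopRep.ρ.invariants) :
    kUnit F L₁ D (j • a) = kUnit F L₁ D a ^ j := by
  induction j with
  | zero => rw [zero_smul, pow_zero]; exact Units.ext (Subtype.ext rfl)
  | succ j ih => rw [add_smul, one_smul, kUnit_add, ih, pow_succ]

variable {D}
variable (hm : 0 < m) (hmL : unramifiedLevel F m ≤ L₁)

omit [CharZero F] [FiniteDimensional F L₁] in
/-- The generator data attached to a cyclic layer `θ` of `Γ_K` with kernel `Γ_{K_m}`: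
`σ` with `θ σ = 1`, whose class generates `Γ_K/Γ_{K_m}`, of order `d`. [folklore] -/
theorem exists_genData {d : ℕ} [NeZero d] (θ : CyclicCharacter (layerN L₁ D) d)
    (hθ : θ.ker = layerS L₁ D (unrLayer F L₁ D m)) :
    haveI := normal_layerN'_subgroupOf L₁ (unrLayer_le F L₁ D m) (normal_unrLayer F L₁ D hm)
    ∃ σ : layerN L₁ D, θ σ = 1 ∧
      (∀ x : layerN L₁ D ⧸ layerS L₁ D (unrLayer F L₁ D m),
        x ∈ Subgroup.zpowers (σ : layerN L₁ D ⧸ layerS L₁ D (unrLayer F L₁ D m))) ∧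
      Nat.card (layerN L₁ D ⧸ layerS L₁ D (unrLayer F L₁ D m)) = d := by
  haveI := normal_layerN'_subgroupOf L₁ (unrLayer_le F L₁ D m) (normal_unrLayer F L₁ D hm)
  obtain ⟨σ, hσ⟩ := θ.exists_map_eq_one
  exact ⟨σ, hσ, θ.forall_mem_zpowers_mk _ hθ hσ, θ.natCard_quotient_eq _ hθ⟩

include hm hmL in
/-- **The norm group of the layer, transported**: `layerBaseUnit a` is a norm from `E'` iff
`m ∣ t_K(kUnit a)` (`range_unitsMap_norm_unrLevel` through `baseEquiv`, `topEquiv`).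
[cite: SerreLocalFields1979, V §2 Cor.] -/
theorem layerBaseUnit_mem_layerNormRange_iff (hfm : fDeg F (fieldOf F L₁ D) ∣ m)
    (a : (layerRep L₁ D).toTopRep.ρ.invariants) :
    layerBaseUnit L₁ D a ∈ layerNormRange L₁ D (unrLayer F L₁ D m) ↔
      (m : ℤ) ∣ tVal F (fieldOf F L₁ D) (kUnit F L₁ D a : fieldOf F L₁ D) := by
  letI := towerAlgebra (le_unrLevel F (fieldOf F L₁ D) m)
  have hmap := map_range_unitsMap_norm_eq
    (baseEquiv F L₁ D : layerBase L₁ D ≃+* fieldOf F L₁ D)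
    (topEquiv F hmL : layerTop L₁ D (unrLayer F L₁ D m) ≃+* _) (topEquiv_comp_algebraMap F hmL)
  rw [← mem_tDvd_iff, ← range_unitsMap_norm_unrLevel F (fieldOf F L₁ D) (le_sepClosure_of_charZero F _)
    hm hfm, ← hmap, ← mapEquiv_layerBaseUnit]
  constructor
  · intro h
    exact Subgroup.mem_map_of_mem _ h
  · rintro ⟨y, hy, hyx⟩
    have h := (Units.mapEquiv _).injective hyx
    rw [← h]
    exact hy

include hm hmL in
/-- **`κ_θ(a) = 0` when `m ∣ t_K(a)`**, for any cyclic layer `θ : Γ_K → ℤ/d` with kernel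
`Γ_{K_m}` (`f_K ∣ m`): `a` is then a norm from `K_m` (`range_unitsMap_norm_unrLevel`), i.e. a
cyclic norm `N_σ b` of a `Γ_{K_m}`-invariant `b` (`exists_cycNorm_eq_of_mem_ker_layerNormQuotHom`),
and `κ(N_σ b) = 0` (`cyclicClass_cycNorm`).  In particular `κ_θ` kills the units of `K`.
[cite: SerreLocalFields1979, XIII §3 Prop. 6, XIV §1 Prop. 3] -/
theorem cyclicClass_eq_zero_of_dvd_tVal (hfm : fDeg F (fieldOf F L₁ D) ∣ m) {d : ℕ} [NeZero d]
    (θ : CyclicCharacter (layerN L₁ D) d) (hθ : θ.ker = layerS L₁ D (unrLayer F L₁ D m))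
    (a : (layerRep L₁ D).toTopRep.ρ.invariants)
    (ha : (m : ℤ) ∣ tVal F (fieldOf F L₁ D) (kUnit F L₁ D a : fieldOf F L₁ D)) :
    cyclicClass θ (layerRep L₁ D) a = 0 := by
  classical
  haveI := normal_layerN'_subgroupOf L₁ (unrLayer_le F L₁ D m) (normal_unrLayer F L₁ D hm)
  obtain ⟨σ, hσ1, hs, hcard⟩ := exists_genData F L₁ hm θ hθ
  haveI : Finite (layerN L₁ D ⧸ layerS L₁ D (unrLayer F L₁ D m)) :=
    Nat.finite_of_card_ne_zero (by rw [hcard]; exact NeZero.ne d)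
  letI : Fintype (layerN L₁ D ⧸ layerS L₁ D (unrLayer F L₁ D m)) := Fintype.ofFinite _
  have ha' : a ∈ (layerNormQuotHom L₁ D (unrLayer F L₁ D m)).ker := by
    rw [AddMonoidHom.mem_ker, layerNormQuotHom_apply, ofMul_eq_zero, QuotientGroup.eq_one_iff]
    exact (layerBaseUnit_mem_layerNormRange_iff F L₁ hm hmL hfm a).2 ha
  obtain ⟨b, hb, hba⟩ := exists_cycNorm_eq_of_mem_ker_layerNormQuotHom L₁ (unrLayer_le F L₁ D m)
    (normal_unrLayer F L₁ D hm) _ hs hcard rfl a ha'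
  have hb' : ∀ t ∈ θ.ker, layerRep L₁ D t b = b := fun t ht => hb t (hθ ▸ ht)
  have hab : a = ⟨(layerRep L₁ D).cycNorm σ d b, apply_cycNorm_eq θ (layerRep L₁ D) hσ1 hb'⟩ :=
    Subtype.ext hba.symm
  rw [hab]
  exact cyclicClass_cycNorm θ (layerRep L₁ D) hσ1 hb'

include hmL in
/-- **A `Γ_{K_m}`-invariant unit of `F̄` lies in `K_m`** (characteristic `0`). [folklore] -/
theorem unitsVal_mem_unrLevel_of_forall {b : UnitsCarrier F}
    (hb : ∀ t ∈ layerS L₁ D (unrLayer F L₁ D m), layerRep L₁ D t b = b) :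
    ((unitsVal F b : (AlgebraicClosure F)ˣ) : AlgebraicClosure F) ∈ unrLevel F (fieldOf F L₁ D) m := by
  obtain ⟨k, hk⟩ := exists_pow_mem_of_forall_smul_eq (unrLevel F (fieldOf F L₁ D) m)
    ((unitsVal F b : (AlgebraicClosure F)ˣ) : AlgebraicClosure F) (fun σ hσ => by
      rw [← layerN_unrLayer F L₁ D hmL] at hσ
      have h := congrArg (fun w : UnitsCarrier F => ((unitsVal F w : (AlgebraicClosure F)ˣ) :
        AlgebraicClosure F)) (hb ⟨σ, Subgroup.comap_mono (unrLayer_le F L₁ D m) hσ⟩ hσ)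
      exact h)
  simpa only [ringExpChar.eq_one, one_pow, pow_one] using hk

include hm hmL in
/-- **`κ_θ(π_K)` has order divisible by `d = m / f_K`**: for `a` with `t_K(a) = f_K` (a uniformiser
of `K`) and a cyclic layer `θ : Γ_K → ℤ/d` with kernel `Γ_{K_m}`, if `j · κ_θ(a) = 0` then
`(m / f_K) ∣ j`.  Indeed `κ(a^j) = 0` makes `a^j` a cyclic norm `N_σ b` of a `Γ_{K_m}`-invariant `b`
(`exists_cycNorm_eq_of_cyclicClass_eq_zero`, Hilbert 90 for `Γ_{K_m}`), `b ∈ K_m` and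
`N_σ b = N_{K_m/K}(b)` (`unitsVal_cycNorm_unitOfTop`), so `m = f_{K_m} ∣ t_K(a^j) = j f_K`.
[cite: SerreLocalFields1979, XIII §3 Prop. 6 and Cor.] -/
theorem div_dvd_of_nsmul_cyclicClass_eq_zero (hfm : fDeg F (fieldOf F L₁ D) ∣ m) {d : ℕ} [NeZero d]
    [Fact (1 < d)] (θ : CyclicCharacter (layerN L₁ D) d)
    (hθ : θ.ker = layerS L₁ D (unrLayer F L₁ D m)) (a : (layerRep L₁ D).toTopRep.ρ.invariants)
    (hta : tVal F (fieldOf F L₁ D) (kUnit F L₁ D a : fieldOf F L₁ D) = fDeg F (fieldOf F L₁ D))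
    {j : ℕ} (hj : j • cyclicClass θ (layerRep L₁ D) a = 0) : m / fDeg F (fieldOf F L₁ D) ∣ j := by
  classical
  haveI := normal_layerN'_subgroupOf L₁ (unrLayer_le F L₁ D m) (normal_unrLayer F L₁ D hm)
  letI := towerAlgebra (le_unrLevel F (fieldOf F L₁ D) m)
  obtain ⟨σ, hσ1, hs, hcard⟩ := exists_genData F L₁ hm θ hθ
  haveI : Finite (layerN L₁ D ⧸ layerS L₁ D (unrLayer F L₁ D m)) :=
    Nat.finite_of_card_ne_zero (by rw [hcard]; exact NeZero.ne d)
  letI : Fintype (layerN L₁ D ⧸ layerS L₁ D (unrLayer F L₁ D m)) := Fintype.ofFinite _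
  -- Hilbert 90 for `Γ_{K_m}`
  haveI : FiniteDimensional F (lift (fixedField (unrLayer F L₁ D m))) :=
    (liftAlgEquiv (fixedField (unrLayer F L₁ D m))).toLinearEquiv.finiteDimensional
  have h1 : Subsingleton (continuousCohomology 1
      ((layerRep L₁ D).restrict (subgroupIncl (layerS L₁ D (unrLayer F L₁ D m)))).toTopRep) :=
    (subsingleton_iff_of_continuousMulEquiv (layerSEquiv L₁ (unrLayer_le F L₁ D m))
      ((units F).restrict (subgroupIncl (galFixing F (lift (fixedField (unrLayer F L₁ D m))))))
      ((layerRep L₁ D).restrict (subgroupIncl (layerS L₁ D (unrLayer F L₁ D m)))) (fun _ _ => rfl)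
      1).1 (subsingleton_one_units_galFixing (lift (fixedField (unrLayer F L₁ D m))))
  have hT : Subsingleton (continuousCohomology 1
      (((layerRep L₁ D).restrict (subgroupIncl θ.ker))).toTopRep) := by
    rw [hθ]
    exact h1
  -- `a^j` is a cyclic norm
  have h0 : cyclicClass θ (layerRep L₁ D) (j • a) = 0 := by rw [map_nsmul, hj]
  obtain ⟨b, hb, hba⟩ := exists_cycNorm_eq_of_cyclicClass_eq_zero θ (layerRep L₁ D) hσ1 hT (j • a) h0
  have hbS : ∀ t ∈ layerS L₁ D (unrLayer F L₁ D m), layerRep L₁ D t b = b := fun t ht =>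
    hb t (hθ ▸ ht)
  -- `b ∈ K_m`, nonzero
  have hbmem := unitsVal_mem_unrLevel_of_forall F L₁ hmL hbS
  let z : unrLevel F (fieldOf F L₁ D) m := ⟨_, hbmem⟩
  have hz0 : z ≠ 0 := fun h => (unitsVal F b).ne_zero (congrArg Subtype.val h)
  -- `N_σ b = N_{K_m/K}(z)` in `F̄`
  let y : layerTop L₁ D (unrLayer F L₁ D m) := (topEquiv F hmL).symm z
  have hy0 : ((y : L₁) : AlgebraicClosure F) ≠ 0 := fun h => (unitsVal F b).ne_zero h
  have hby : b = unitOfTop L₁ y hy0 := by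
    apply unitsVal_injective F
    exact Units.ext rfl
  have hnorm : ((unitsVal F ((layerRep L₁ D).cycNorm σ d b) : (AlgebraicClosure F)ˣ) :
      AlgebraicClosure F) = ((Algebra.norm (fieldOf F L₁ D) (z : unrLevel F (fieldOf F L₁ D) m) : fieldOf F L₁ D) : AlgebraicClosure F) := by
    rw [hby, unitsVal_cycNorm_unitOfTop L₁ (unrLayer_le F L₁ D m) (normal_unrLayer F L₁ D hm) _ hs
      hcard rfl y hy0]
    have h := norm_equiv_apply (baseEquiv F L₁ D : layerBase L₁ D ≃+* fieldOf F L₁ D)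
      (topEquiv F hmL : layerTop L₁ D (unrLayer F L₁ D m) ≃+* _) (topEquiv_comp_algebraMap F hmL) y
    have hyz : (topEquiv F hmL : layerTop L₁ D (unrLayer F L₁ D m) ≃+* _) y = z :=
      (topEquiv F hmL).apply_symm_apply z
    rw [hyz] at h
    rw [h]
    rfl
  -- hence `(kUnit a)^j = N_{K_m/K}(z)` in `K`
  have hpow : ((kUnit F L₁ D a : (fieldOf F L₁ D)ˣ) : fieldOf F L₁ D) ^ j =
      Algebra.norm (fieldOf F L₁ D) (z : unrLevel F (fieldOf F L₁ D) m) := by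
    apply Subtype.ext
    change (((kUnit F L₁ D a ^ j : (fieldOf F L₁ D)ˣ) : fieldOf F L₁ D) : AlgebraicClosure F) = _
    rw [← kUnit_nsmul, coe_kUnit, ← hnorm, hba]
  -- valuations: `j f_K = t_K(N z) ∈ m ℤ`
  have hdvd : (m : ℤ) ∣ tVal F (fieldOf F L₁ D) (((kUnit F L₁ D a : (fieldOf F L₁ D)ˣ) : fieldOf F L₁ D) ^ j) := by
    rw [hpow]
    exact dvd_tVal_norm_unrLevel F (fieldOf F L₁ D) (le_sepClosure_of_charZero F _) hm hfm _ hz0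
  rw [tVal_pow F (fieldOf F L₁ D) (kUnit F L₁ D a).ne_zero, hta] at hdvd
  obtain ⟨d', hd'⟩ := hfm
  have hf := fDeg_pos F (fieldOf F L₁ D)
  rw [hd', Nat.mul_div_cancel_left _ hf]
  rw [hd', Nat.cast_mul, mul_comm (j : ℤ)] at hdvd
  exact Int.natCast_dvd_natCast.1 ((mul_dvd_mul_iff_left (by exact_mod_cast hf.ne')).1 hdvd)

include hm hmL in
/-- **The unramified character exists**: a cyclic layer `Γ_K → ℤ/(m/f_K)` with kernel `Γ_{K_m}`
(`f_K ∣ m`, `F_m ≤ L₁`), from a generator of the cyclic group `Γ_K/Γ_{K_m}` (`layerChar`).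
[cite: SerreLocalFields1979, XIII §3] -/
theorem exists_unrChar (hfm : fDeg F (fieldOf F L₁ D) ∣ m) :
    ∃ θ : CyclicCharacter (layerN L₁ D) (m / fDeg F (fieldOf F L₁ D)),
      θ.ker = layerS L₁ D (unrLayer F L₁ D m) := by
  haveI := normal_layerN'_subgroupOf L₁ (unrLayer_le F L₁ D m) (normal_unrLayer F L₁ D hm)
  haveI := isCyclic_quot_unrLayer F L₁ D hm hmL
  haveI : NeZero (m / fDeg F (fieldOf F L₁ D)) :=
    ⟨(Nat.div_pos (Nat.le_of_dvd hm hfm) (fDeg_pos F _)).ne'⟩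
  obtain ⟨s, hs⟩ := IsCyclic.exists_generator (α := layerN L₁ D ⧸ layerS L₁ D (unrLayer F L₁ D m))
  exact ⟨layerChar L₁ s hs (natCard_quot_unrLayer F L₁ D hm hmL hfm)
    (isOpen_layerN'_subgroupOf L₁ D _), ker_layerChar L₁ s hs _ _⟩

end Classes

end Literature.NumberTheory.GaloisRepresentations

end
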